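import Mathlib
import Summits.PneNP.PneNP.Theorems.CnfIdealGenLengthRankDefectRepresentationsSchurDomination

/-!
# Crux `RankDefectRepresentations` (stmt-PneNP-18923), line `rank-dehn-ladder`: ANTIPODAL DOMINATION — of two antipodal quadrants of a
# two-family instance, one determines the other up to four times the slack of the cut budget (lead g14; memo
# `Cruxes/RankDefectRepresentations/Lines/rank-dehn-ladder-g14.md` §3(c))

For a two-family instance `D` (rows/columns coloured by `{0,1}^n × {0,1}^{n'}`, `doubleCut row col T T' D ≤ c` for all `(T,T')`) and ANY pair
of cuts `(B, B′)`: fix one rectangle of the quadrant `B × B′` — rows of type `S₁ × S₁′`, columns of type `(B∖S₁) × (B′∖S₁′)` — as a matrix `A`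
of rank `a`.  Then a SINGLE matrix `W` of rank `≤ a` satisfies, for EVERY rectangle of the antipodal quadrant `Bᶜ × B′ᶜ` (rows `S₂ × S₂′`, columns
`(Bᶜ∖S₂) × (B′ᶜ∖S₂′)`):  `rank ((D − W)|rectangle) + 4a ≤ 4c`  (`antipodal_domination`).  So an antipodal quadrant within `δ` of saturating the
budget forces the other to be a rank-`c` matrix plus an instance of cut budget `≤ 4δ` — the first budget-DECAY statement on the line.  Proof: the two
rectangles are the diagonal blocks of a sub-block of the rectangle `R(S₁ ∪ S₂, S₁′ ∪ S₂′)`, coupled through sub-blocks of `R(B,B′)` and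
`R(Bᶜ,B′ᶜ)`; `schur_domination` (p704913) with a generalised inverse of `A` supported on the transposed support (`exists_gInverse`), and
`W = F_all · G · E_all` with `F_all`, `E_all` the full coupling blocks.
HONEST FRAMING: negative-lane tool; `stub_merge` / `stub_coreLinear` and the crux stay open; P ≠ NP is not moved; F-N2 is a FRONTIER formal rung.
-/

set_option linter.dupNamespace false -- `Summit.PneNP.PneNP.…`: summit = sub-problem name (D-0017)

namespace Summit.PneNP.PneNP.Theorems.CnfIdealGenLengthRankDefectRepresentationsAntipodalDomination

open Matrix Finset
open Summit.PneNP.PneNP.Theorems.CnfIdealGenLengthRankDefectRepresentationsStripCompletion (rank_mask_le)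
open Summit.PneNP.PneNP.Theorems.CnfIdealGenLengthRankDefectRepresentationsSchurDomination
  (dmask dmask_mul_apply mul_dmask_apply exists_gInverse schur_domination)

variable {K : Type} [Field K]

section Antipodal

open Summit.PneNP.PneNP.Theorems.CnfIdealGenLengthRankDefectRepresentationsTwoFamilyCutDomination (colourI colourJ doubleCut)
open Summit.PneNP.PneNP.Theorems.CnfIdealGenLengthRankDefectRepresentationsQuadrantCapture (rect rect_apply doubleCut_eq_sum_four)

variable {n n' : ℕ} {ι ι' : Type} [Fintype ι] [Fintype ι'] [DecidableEq ι] [DecidableEq ι']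
variable (row : ι → Fin n ⊕ Fin n' → Bool) (col : ι' → Fin n ⊕ Fin n' → Bool)

/-- **ANTIPODAL DOMINATION** (memo g14 §3(c)).  Fix ANY pair of cuts `(B, B′)` and one rectangle of the quadrant `B × B′`: rows of type
`S₁ × S₁′`, columns of type `(B∖S₁) × (B′∖S₁′)`, as the matrix `A` (rank `a`).  Then ONE matrix `W` of rank `≤ a` satisfies, for EVERY rectangle of
the antipodal quadrant `Bᶜ × B′ᶜ` (rows `S₂ × S₂′`, columns `(Bᶜ∖S₂) × (B′ᶜ∖S₂′)`):  `rank ((D − W)|rectangle) + 4a ≤ 4c`, where `c` bounds the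
double cuts — the two rectangles are the diagonal blocks of a sub-block of the rectangle `R(S₁ ∪ S₂, S₁′ ∪ S₂′)`, coupled through sub-blocks of
`R(B,B′)` and `R(Bᶜ,B′ᶜ)`, and `schur_domination` applies with a generalised inverse of `A`. -/
theorem antipodal_domination (D : Matrix ι ι' K) (c : ℕ) (hc : ∀ T T', doubleCut row col T T' D ≤ c)
    (B S₁ : Finset (Fin n → Bool)) (B' S₁' : Finset (Fin n' → Bool)) (hS₁ : S₁ ⊆ B) (hS₁' : S₁' ⊆ B') :
    ∃ W : Matrix ι ι' K,
      W.rank ≤ (Matrix.of fun x y => if (colourI (row x) ∈ S₁ ∧ colourJ (row x) ∈ S₁') ∧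
          (colourI (col y) ∈ B \ S₁ ∧ colourJ (col y) ∈ B' \ S₁') then D x y else 0).rank ∧
      ∀ (S₂ : Finset (Fin n → Bool)) (S₂' : Finset (Fin n' → Bool)), S₂ ⊆ Bᶜ → S₂' ⊆ B'ᶜ →
        (Matrix.of fun x y => if (colourI (row x) ∈ S₂ ∧ colourJ (row x) ∈ S₂') ∧
            (colourI (col y) ∈ Bᶜ \ S₂ ∧ colourJ (col y) ∈ B'ᶜ \ S₂') then (D - W) x y else 0).rank +
          4 * (Matrix.of fun x y => if (colourI (row x) ∈ S₁ ∧ colourJ (row x) ∈ S₁') ∧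
              (colourI (col y) ∈ B \ S₁ ∧ colourJ (col y) ∈ B' \ S₁') then D x y else 0).rank ≤ 4 * c := by
  classical
  -- supports
  let p : ι → Prop := fun x => colourI (row x) ∈ S₁ ∧ colourJ (row x) ∈ S₁'
  let qA : ι' → Prop := fun y => colourI (col y) ∈ B \ S₁ ∧ colourJ (col y) ∈ B' \ S₁'
  let r22 : ι → Prop := fun x => colourI (row x) ∈ Bᶜ ∧ colourJ (row x) ∈ B'ᶜ
  let c22 : ι' → Prop := fun y => colourI (col y) ∈ Bᶜ ∧ colourJ (col y) ∈ B'ᶜ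
  set A : Matrix ι ι' K := Matrix.of fun x y => if p x ∧ qA y then D x y else 0 with hA
  have hAp : ∀ x y, ¬ p x → A x y = 0 := fun x y hx => by rw [hA, Matrix.of_apply, if_neg (fun h => hx h.1)]
  have hAq : ∀ x y, ¬ qA y → A x y = 0 := fun x y hy => by rw [hA, Matrix.of_apply, if_neg (fun h => hy h.2)]
  obtain ⟨G, hG, hGr, hGq', hGp'⟩ := exists_gInverse A p qA hAp hAq
  -- the aligning matrix
  set Fall : Matrix ι ι' K := Matrix.of fun x y => if r22 x ∧ qA y then D x y else 0 with hFall
  set Eall : Matrix ι ι' K := Matrix.of fun x y => if p x ∧ c22 y then D x y else 0 with hEall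
  refine ⟨Fall * G * Eall, ?_, ?_⟩
  · exact ((Matrix.rank_mul_le_left _ _).trans (Matrix.rank_mul_le_right _ _)).trans hGr
  intro S₂ S₂' hS₂ hS₂'
  let p₂ : ι → Prop := fun x => colourI (row x) ∈ S₂ ∧ colourJ (row x) ∈ S₂'
  let q : ι' → Prop := fun y => colourI (col y) ∈ Bᶜ \ S₂ ∧ colourJ (col y) ∈ B'ᶜ \ S₂'
  set E : Matrix ι ι' K := Matrix.of fun x y => if p x ∧ q y then D x y else 0 with hE
  set F : Matrix ι ι' K := Matrix.of fun x y => if p₂ x ∧ qA y then D x y else 0 with hF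
  set Bq : Matrix ι ι' K := Matrix.of fun x y => if p₂ x ∧ q y then D x y else 0 with hBq
  -- basic incidences
  have hp_p₂ : ∀ x, p x → ¬ p₂ x := by
    intro x hx h2
    have h1 : colourI (row x) ∈ B := hS₁ hx.1
    have h3 : colourI (row x) ∈ Bᶜ := hS₂ h2.1
    exact (Finset.mem_compl.mp h3) h1
  have hq_qA : ∀ y, q y → ¬ qA y := by
    intro y hy h
    have h1 : colourI (col y) ∈ B := (Finset.mem_sdiff.mp h.1).1
    have h2 : colourI (col y) ∈ Bᶜ := (Finset.mem_sdiff.mp hy.1).1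
    exact (Finset.mem_compl.mp h2) h1
  have hp₂_r22 : ∀ x, p₂ x → r22 x := fun x h => ⟨hS₂ h.1, hS₂' h.2⟩
  have hq_c22 : ∀ y, q y → c22 y := fun y h => ⟨(Finset.mem_sdiff.mp h.1).1, (Finset.mem_sdiff.mp h.2).1⟩
  -- `F = dmask p₂ * Fall`, `E = Eall * dmask q`, `Bq = dmask p₂ * D * dmask q`
  have hFm : F = dmask K p₂ * Fall := by
    ext x y; rw [dmask_mul_apply, hF, hFall, Matrix.of_apply, Matrix.of_apply]
    by_cases h2 : p₂ x
    · simp only [h2, true_and, if_true, hp₂_r22 x h2]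
    · simp [h2]
  have hEm : E = Eall * dmask K q := by
    ext x y; rw [mul_dmask_apply, hE, hEall, Matrix.of_apply, Matrix.of_apply]
    by_cases h2 : q y
    · simp only [h2, and_true, if_true, hq_c22 y h2]
    · simp [h2]
  have hBm : Bq = dmask K p₂ * D * dmask K q := by
    ext x y; rw [mul_dmask_apply, dmask_mul_apply, hBq, Matrix.of_apply]
    by_cases h1 : p₂ x <;> by_cases h2 : q y <;> simp [h1, h2]
  have hFGE : F * G * E = dmask K p₂ * (Fall * G * Eall) * dmask K q := by
    rw [hFm, hEm]; simp only [Matrix.mul_assoc]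
  have hblock : (Matrix.of fun x y => if p₂ x ∧ q y then (D - Fall * G * Eall) x y else 0) = Bq - F * G * E := by
    rw [hFGE, hBm]
    ext x y
    simp only [Matrix.of_apply, Matrix.sub_apply, mul_dmask_apply, dmask_mul_apply]
    by_cases h1 : p₂ x <;> by_cases h2 : q y <;> simp [h1, h2]
  -- the coupled block matrix is a sub-block of the rectangle `R(S₁ ∪ S₂, S₁′ ∪ S₂′)`
  have hM : (A + E + F + Bq).rank ≤ c := by
    set Rt : Matrix ι ι' K := rect row col (S₁ ∪ S₂) (S₁' ∪ S₂') true true D with hRt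
    have e : A + E + F + Bq = Matrix.of fun x y => if (p x ∨ p₂ x) ∧ (qA y ∨ q y) then Rt x y else 0 := by
      ext x y
      simp only [hA, hE, hF, hBq, hRt, Matrix.add_apply, Matrix.of_apply, rect_apply, Bool.not_true, decide_eq_true_eq,
        decide_eq_false_iff_not, Finset.mem_union]
      by_cases a1 : p x <;> by_cases a2 : p₂ x <;> by_cases b1 : qA y <;> by_cases b2 : q y
      all_goals first
        | (exfalso; exact hp_p₂ x a1 a2)
        | (exfalso; exact hq_qA y b2 b1)
        | skip
      all_goals simp only [a1, a2, b1, b2, and_true, and_false, or_true, or_false, if_true, if_false, add_zero, zero_add]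
      -- the surviving cases: (row, col) ∈ {p, p₂} × {qA, q} — the rectangle entry is `D x y`
      · -- p, qA
        have hr : (colourI (row x) ∈ S₁ ∨ colourI (row x) ∈ S₂) ∧ (colourJ (row x) ∈ S₁' ∨ colourJ (row x) ∈ S₂') :=
          ⟨Or.inl a1.1, Or.inl a1.2⟩
        have hcI : ¬ (colourI (col y) ∈ S₁ ∨ colourI (col y) ∈ S₂) := by
          rintro (h | h)
          · exact (Finset.mem_sdiff.mp b1.1).2 h
          · exact (Finset.mem_compl.mp (hS₂ h)) (Finset.mem_sdiff.mp b1.1).1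
        have hcJ : ¬ (colourJ (col y) ∈ S₁' ∨ colourJ (col y) ∈ S₂') := by
          rintro (h | h)
          · exact (Finset.mem_sdiff.mp b1.2).2 h
          · exact (Finset.mem_compl.mp (hS₂' h)) (Finset.mem_sdiff.mp b1.2).1
        simp [hr, hcI, hcJ]
      · -- p, q
        have hr : (colourI (row x) ∈ S₁ ∨ colourI (row x) ∈ S₂) ∧ (colourJ (row x) ∈ S₁' ∨ colourJ (row x) ∈ S₂') :=
          ⟨Or.inl a1.1, Or.inl a1.2⟩
        have hcI : ¬ (colourI (col y) ∈ S₁ ∨ colourI (col y) ∈ S₂) := by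
          rintro (h | h)
          · exact (Finset.mem_compl.mp (Finset.mem_sdiff.mp b2.1).1) (hS₁ h)
          · exact (Finset.mem_sdiff.mp b2.1).2 h
        have hcJ : ¬ (colourJ (col y) ∈ S₁' ∨ colourJ (col y) ∈ S₂') := by
          rintro (h | h)
          · exact (Finset.mem_compl.mp (Finset.mem_sdiff.mp b2.2).1) (hS₁' h)
          · exact (Finset.mem_sdiff.mp b2.2).2 h
        simp [hr, hcI, hcJ]
      · -- p₂, qA
        have hr : (colourI (row x) ∈ S₁ ∨ colourI (row x) ∈ S₂) ∧ (colourJ (row x) ∈ S₁' ∨ colourJ (row x) ∈ S₂') :=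
          ⟨Or.inr a2.1, Or.inr a2.2⟩
        have hcI : ¬ (colourI (col y) ∈ S₁ ∨ colourI (col y) ∈ S₂) := by
          rintro (h | h)
          · exact (Finset.mem_sdiff.mp b1.1).2 h
          · exact (Finset.mem_compl.mp (hS₂ h)) (Finset.mem_sdiff.mp b1.1).1
        have hcJ : ¬ (colourJ (col y) ∈ S₁' ∨ colourJ (col y) ∈ S₂') := by
          rintro (h | h)
          · exact (Finset.mem_sdiff.mp b1.2).2 h
          · exact (Finset.mem_compl.mp (hS₂' h)) (Finset.mem_sdiff.mp b1.2).1
        simp [hr, hcI, hcJ]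
      · -- p₂, q
        have hr : (colourI (row x) ∈ S₁ ∨ colourI (row x) ∈ S₂) ∧ (colourJ (row x) ∈ S₁' ∨ colourJ (row x) ∈ S₂') :=
          ⟨Or.inr a2.1, Or.inr a2.2⟩
        have hcI : ¬ (colourI (col y) ∈ S₁ ∨ colourI (col y) ∈ S₂) := by
          rintro (h | h)
          · exact (Finset.mem_compl.mp (Finset.mem_sdiff.mp b2.1).1) (hS₁ h)
          · exact (Finset.mem_sdiff.mp b2.1).2 h
        have hcJ : ¬ (colourJ (col y) ∈ S₁' ∨ colourJ (col y) ∈ S₂') := by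
          rintro (h | h)
          · exact (Finset.mem_compl.mp (Finset.mem_sdiff.mp b2.2).1) (hS₁' h)
          · exact (Finset.mem_sdiff.mp b2.2).2 h
        simp [hr, hcI, hcJ]
    rw [e]
    refine (rank_mask_le _ _ Rt).trans ?_
    have h4 := doubleCut_eq_sum_four row col (S₁ ∪ S₂) (S₁' ∪ S₂') D
    have := hc (S₁ ∪ S₂) (S₁' ∪ S₂')
    rw [hRt]; omega
  -- apply Schur domination
  have hdom := schur_domination A E F Bq G p q
    hAp (fun x y hy => hAq x y (hq_qA y hy))
    (fun x y hx => by rw [hE, Matrix.of_apply, if_neg (fun h => hx h.1)])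
    (fun x y hy => by rw [hE, Matrix.of_apply, if_neg (fun h => hy h.2)])
    (fun x y hx => by rw [hF, Matrix.of_apply, if_neg (fun h => hp_p₂ x hx h.1)])
    (fun x y hy => by rw [hF, Matrix.of_apply, if_neg (fun h => hq_qA y hy h.2)])
    (fun x y hx => by rw [hBq, Matrix.of_apply, if_neg (fun h => hp_p₂ x hx h.1)])
    (fun x y hy => by rw [hBq, Matrix.of_apply, if_neg (fun h => hy h.2)])
    hG (fun y x hy => hGq' y x (hq_qA y hy)) hGp'
  rw [hblock]
  exact hdom.trans (Nat.mul_le_mul_left 4 hM)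

end Antipodal

end Summit.PneNP.PneNP.Theorems.CnfIdealGenLengthRankDefectRepresentationsAntipodalDomination
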